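import Mathlib
import Literature.Analysis.PDE.SingleEntropy.SupersolutionTools
import HarnessLib

/-!
# Prop. 3.2 of De Lellis–Otto–Westdickenberg in weighted form

Topic `Literature/Analysis/PDE/SingleEntropy` — part of the formalization of
De Lellis–Otto–Westdickenberg, *Minimal entropy conditions for Burgers equation*, Quart. Appl.
Math. 62 (2004) 687–700, Thm 2.3 / Cor 2.5 (the named fact
`Literature.Analysis.PDE.deLellisOttoWestdickenberg_singleEntropy`).

`dlow_prop32_weighted`: for a bounded measurable nonnegative weight `w` vanishing off a compact set,
with `m = ∫ w` and `A_g = ∫ w · g(U)`,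
`(ab/24) ∬ w(z) w(z') (U z - U z')⁴ ≤ m A_{uq} - m A_{ηf} + A_f A_η - A_u A_q`
(average of the pointwise kernel inequality `dlow_kernel_ineq`).
[cite: DelellisOttoWestdickenberg2004, Prop. 3.2]
-/

noncomputable section

open MeasureTheory Set Filter Metric ContinuousLinearMap
open scoped Topology Convolution NNReal

namespace Literature.Analysis.PDE.SingleEntropy

/-! ## Weighted form of Prop. 3.2 -/

section WeightedAverages

/-- A weight times a continuous function of a bounded measurable function is integrable, when
the weight is bounded, measurable and vanishes off a compact set. [folklore] -/
theorem integrable_weight_mul {w : ℝ × ℝ → ℝ} (hwm : Measurable w) {Cw : ℝ}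
    (hwC : ∀ z, |w z| ≤ Cw) {K : Set (ℝ × ℝ)} (hK : IsCompact K) (hwK : ∀ z ∉ K, w z = 0)
    {U : ℝ × ℝ → ℝ} (hU : Measurable U) {M : ℝ} (hUM : ∀ z, |U z| ≤ M) {G : ℝ → ℝ}
    (hG : Continuous G) : Integrable (fun z => w z * G (U z)) volume := by
  obtain ⟨A, hA0, hA⟩ := exists_abs_le_on_Icc hG M
  refine Integrable.mono' (g := K.indicator fun _ => Cw * A) ?_
    ((hwm.mul (hG.measurable.comp hU)).aestronglyMeasurable) (ae_of_all _ fun z => ?_)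
  · rw [integrable_indicator_iff hK.measurableSet]
    exact integrableOn_const (hK.measure_lt_top.ne)
  · by_cases hz : z ∈ K
    · rw [indicator_of_mem hz, norm_mul, Real.norm_eq_abs, Real.norm_eq_abs]
      exact mul_le_mul (hwC z) (hA _ (hUM z)) (abs_nonneg _) ((abs_nonneg _).trans (hwC z))
    · rw [indicator_of_notMem hz, hwK z hz]; simp

/-- Product version of `integrable_weight_mul` on `ℝ² × ℝ²`. [folklore] -/
theorem integrable_weight_prod {w : ℝ × ℝ → ℝ} (hwm : Measurable w) {Cw : ℝ}
    (hwC : ∀ z, |w z| ≤ Cw) {K : Set (ℝ × ℝ)} (hK : IsCompact K) (hwK : ∀ z ∉ K, w z = 0)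
    {U : ℝ × ℝ → ℝ} (hU : Measurable U) {M : ℝ} (hUM : ∀ z, |U z| ≤ M) {G : ℝ × ℝ → ℝ}
    (hG : Continuous G) :
    Integrable (fun p : (ℝ × ℝ) × (ℝ × ℝ) => w p.1 * w p.2 * G (U p.1, U p.2))
      (volume.prod volume) := by
  obtain ⟨A, hA⟩ := ((isCompact_Icc (a := -M) (b := M)).prod
    (isCompact_Icc (a := -M) (b := M))).exists_bound_of_continuousOn hG.continuousOn
  have hA0 : 0 ≤ A := (norm_nonneg _).trans (hA (U (0, 0), U (0, 0))
    (mem_prod.mpr ⟨mem_Icc.mpr (abs_le.mp (hUM _)), mem_Icc.mpr (abs_le.mp (hUM _))⟩))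
  have hm : Measurable fun p : (ℝ × ℝ) × (ℝ × ℝ) => (U p.1, U p.2) :=
    (hU.comp measurable_fst).prodMk (hU.comp measurable_snd)
  refine Integrable.mono' (g := (K ×ˢ K).indicator fun _ => Cw * Cw * A) ?_
    (((hwm.comp measurable_fst).mul (hwm.comp measurable_snd)).mul (hG.measurable.comp hm)
      |>.aestronglyMeasurable) (ae_of_all _ fun p => ?_)
  · rw [integrable_indicator_iff (hK.prod hK).measurableSet]
    exact integrableOn_const ((hK.prod hK).measure_lt_top.ne)
  · by_cases hp : p ∈ K ×ˢ K
    · rw [indicator_of_mem hp, norm_mul, norm_mul, Real.norm_eq_abs, Real.norm_eq_abs]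
      have h3 := hA (U p.1, U p.2)
        (mem_prod.mpr ⟨mem_Icc.mpr (abs_le.mp (hUM _)), mem_Icc.mpr (abs_le.mp (hUM _))⟩)
      have hCw : 0 ≤ Cw := (abs_nonneg _).trans (hwC p.1)
      exact mul_le_mul (mul_le_mul (hwC _) (hwC _) (abs_nonneg _) hCw) h3 (norm_nonneg _)
        (mul_nonneg hCw hCw)
    · rw [indicator_of_notMem hp]
      rw [mem_prod, not_and_or] at hp
      rcases hp with h1 | h1
      · rw [hwK _ h1]; simp
      · rw [hwK _ h1]; simp

/-- **Prop. 3.2 (b)–(c), weighted form.** For a bounded measurable nonnegative weight `w`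
vanishing off a compact set, with `m = ∫ w` and `A_g = ∫ w · g(U)`:
`(ab/24) ∬ w(z) w(z') (U z - U z')⁴ ≤ m A_{uq} - m A_{ηf} + A_f A_η - A_u A_q`.
[cite: DelellisOttoWestdickenberg2004, Prop. 3.2] -/
theorem dlow_prop32_weighted {w : ℝ × ℝ → ℝ} (hwm : Measurable w) (hw0 : ∀ z, 0 ≤ w z) {Cw : ℝ}
    (hwC : ∀ z, |w z| ≤ Cw) {K : Set (ℝ × ℝ)} (hK : IsCompact K) (hwK : ∀ z ∉ K, w z = 0)
    {U : ℝ × ℝ → ℝ} (hU : Measurable U) {M : ℝ} (hUM : ∀ z, |U z| ≤ M)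
    {f η q : ℝ → ℝ} {a b : ℝ} (hf : ContDiff ℝ 2 f) (hη : ContDiff ℝ 2 η) (ha : 0 ≤ a)
    (hb : 0 ≤ b) (hfa : ∀ w, a ≤ deriv (deriv f) w) (hηb : ∀ w, b ≤ deriv (deriv η) w)
    (hq : ∀ w, HasDerivAt q (deriv f w * deriv η w) w) :
    a * b / 24 * ∫ z, ∫ z', w z * w z' * (U z - U z') ^ 4 ≤
      (∫ z, w z) * (∫ z, w z * (U z * q (U z))) - (∫ z, w z) * (∫ z, w z * (η (U z) * f (U z)))
        + (∫ z, w z * f (U z)) * (∫ z, w z * η (U z))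
        - (∫ z, w z * U z) * (∫ z, w z * q (U z)) := by
  have hqc : Continuous q := continuous_iff_continuousAt.2 fun w => (hq w).continuousAt
  have hfc : Continuous f := hf.continuous
  have hηc : Continuous η := hη.continuous
  set μ2 : Measure ((ℝ × ℝ) × (ℝ × ℝ)) := volume.prod volume with hμ2
  have hKi : Integrable (fun p : (ℝ × ℝ) × (ℝ × ℝ) => w p.1 * w p.2 *
      ((U p.1 - U p.2) * (q (U p.1) - q (U p.2)) - (η (U p.1) - η (U p.2)) * (f (U p.1) - f (U p.2))))
      μ2 :=
    integrable_weight_prod hwm hwC hK hwK hU hUM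
      (G := fun c => (c.1 - c.2) * (q c.1 - q c.2) - (η c.1 - η c.2) * (f c.1 - f c.2))
      (by fun_prop)
  have h4i : Integrable (fun p : (ℝ × ℝ) × (ℝ × ℝ) => w p.1 * w p.2 * (U p.1 - U p.2) ^ 4) μ2 :=
    integrable_weight_prod hwm hwC hK hwK hU hUM (G := fun c => (c.1 - c.2) ^ 4) (by fun_prop)
  have h1 : ∫ z, ∫ z', w z * w z' * (U z - U z') ^ 4
      = ∫ p, w p.1 * w p.2 * (U p.1 - U p.2) ^ 4 ∂μ2 := (integral_prod _ h4i).symm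
  have h2 : ∫ p, a * b / 12 * (w p.1 * w p.2 * (U p.1 - U p.2) ^ 4) ∂μ2
      ≤ ∫ p, w p.1 * w p.2 * ((U p.1 - U p.2) * (q (U p.1) - q (U p.2))
          - (η (U p.1) - η (U p.2)) * (f (U p.1) - f (U p.2))) ∂μ2 := by
    apply integral_mono (h4i.const_mul _) hKi
    intro p
    have := dlow_kernel_ineq hf hη ha hb hfa hηb hq (U p.1) (U p.2)
    have hw : 0 ≤ w p.1 * w p.2 := mul_nonneg (hw0 _) (hw0 _)
    nlinarith
  rw [integral_const_mul] at h2
  -- the eight pieces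
  have I : ∀ (G₁ G₂ : ℝ → ℝ), Continuous G₁ → Continuous G₂ →
      Integrable (fun p : (ℝ × ℝ) × (ℝ × ℝ) => (w p.1 * G₁ (U p.1)) * (w p.2 * G₂ (U p.2))) μ2 ∧
      ∫ p, (w p.1 * G₁ (U p.1)) * (w p.2 * G₂ (U p.2)) ∂μ2
        = (∫ z, w z * G₁ (U z)) * (∫ z, w z * G₂ (U z)) := by
    intro G₁ G₂ hG₁ hG₂
    refine ⟨?_, integral_prod_mul (μ := volume) (ν := volume) (fun z => w z * G₁ (U z))
      (fun z => w z * G₂ (U z))⟩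
    exact (integrable_weight_mul hwm hwC hK hwK hU hUM hG₁).mul_prod
      (integrable_weight_mul hwm hwC hK hwK hU hUM hG₂)
  obtain ⟨i1, j1⟩ := I (fun x => x * q x) (fun _ => 1) (by fun_prop) (by fun_prop)
  obtain ⟨i2, j2⟩ := I (fun x => x) (fun x => q x) (by fun_prop) hqc
  obtain ⟨i3, j3⟩ := I (fun x => q x) (fun x => x) hqc (by fun_prop)
  obtain ⟨i4, j4⟩ := I (fun _ => 1) (fun x => x * q x) (by fun_prop) (by fun_prop)
  obtain ⟨i5, j5⟩ := I (fun x => η x * f x) (fun _ => 1) (by fun_prop) (by fun_prop)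
  obtain ⟨i6, j6⟩ := I (fun x => η x) (fun x => f x) hηc hfc
  obtain ⟨i7, j7⟩ := I (fun x => f x) (fun x => η x) hfc hηc
  obtain ⟨i8, j8⟩ := I (fun _ => 1) (fun x => η x * f x) (by fun_prop) (by fun_prop)
  have e : ∫ p, w p.1 * w p.2 * ((U p.1 - U p.2) * (q (U p.1) - q (U p.2))
          - (η (U p.1) - η (U p.2)) * (f (U p.1) - f (U p.2))) ∂μ2
      = ∫ p, ((w p.1 * (U p.1 * q (U p.1))) * (w p.2 * 1)
          - (w p.1 * U p.1) * (w p.2 * q (U p.2))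
          - (w p.1 * q (U p.1)) * (w p.2 * U p.2)
          + (w p.1 * 1) * (w p.2 * (U p.2 * q (U p.2)))
          - (w p.1 * (η (U p.1) * f (U p.1))) * (w p.2 * 1)
          + (w p.1 * η (U p.1)) * (w p.2 * f (U p.2))
          + (w p.1 * f (U p.1)) * (w p.2 * η (U p.2))
          - (w p.1 * 1) * (w p.2 * (η (U p.2) * f (U p.2)))) ∂μ2 := by
    congr 1; funext p; ring
  have split : ∫ p, ((w p.1 * (U p.1 * q (U p.1))) * (w p.2 * 1)
          - (w p.1 * U p.1) * (w p.2 * q (U p.2))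
          - (w p.1 * q (U p.1)) * (w p.2 * U p.2)
          + (w p.1 * 1) * (w p.2 * (U p.2 * q (U p.2)))
          - (w p.1 * (η (U p.1) * f (U p.1))) * (w p.2 * 1)
          + (w p.1 * η (U p.1)) * (w p.2 * f (U p.2))
          + (w p.1 * f (U p.1)) * (w p.2 * η (U p.2))
          - (w p.1 * 1) * (w p.2 * (η (U p.2) * f (U p.2)))) ∂μ2
      = (∫ p, (w p.1 * (U p.1 * q (U p.1))) * (w p.2 * 1) ∂μ2)
        - (∫ p, (w p.1 * U p.1) * (w p.2 * q (U p.2)) ∂μ2)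
        - (∫ p, (w p.1 * q (U p.1)) * (w p.2 * U p.2) ∂μ2)
        + (∫ p, (w p.1 * 1) * (w p.2 * (U p.2 * q (U p.2))) ∂μ2)
        - (∫ p, (w p.1 * (η (U p.1) * f (U p.1))) * (w p.2 * 1) ∂μ2)
        + (∫ p, (w p.1 * η (U p.1)) * (w p.2 * f (U p.2)) ∂μ2)
        + (∫ p, (w p.1 * f (U p.1)) * (w p.2 * η (U p.2)) ∂μ2)
        - (∫ p, (w p.1 * 1) * (w p.2 * (η (U p.2) * f (U p.2))) ∂μ2) := by
    rw [integral_sub, integral_add, integral_add, integral_sub, integral_add, integral_sub,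
      integral_sub]
    all_goals fun_prop
  rw [e, split, j1, j2, j3, j4, j5, j6, j7, j8] at h2
  simp only [mul_one] at h2
  rw [h1]
  nlinarith [h2]

end WeightedAverages

end Literature.Analysis.PDE.SingleEntropy
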